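/-
Copyright: cell pub-balaban-gaps (YM BLITZ Y1, track G1), seat g1-p2 GEN 12 (unit `pub-balaban-gaps-g1-p2`).  Row (D4) NODE O,
MODEL level on 59b–66's carrier — ROAD (c′) of g1-plan-1 GEN 39 ([G1-PLAN1-G39-PRECISION-110], skeleton #26), VALUE-LEVEL END FOR
LATTICE GAUGE FIELDS: 130's glued block walk expansion of `(Δ_W + m² + a_KP_K(U))⁻¹` with its PER-CUBE INPUTS DISCHARGED BY 126 —
for each cube `□`, bond logarithms `X^{(□)}` with 66's two (3.37)-windows `(a₀, a₁)` on a ball and a unit-scale cutoff `χ_□`: the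
χ-truncated field `Ũ^□ = e^{χ_□X^{(□)}}` supplies the whole-torus local inverse (126's END), its defect windows (123), its averaging
rows (66 ∕ 115 ∕ 112) and the holomorphy of its one-scale operator (59b ∕ 64 ∕ 66).  What stays HYPOTHESIS DATA: the gauges `ĝ_□`
(fibre row letter `r_g`), the partition `h_□` with its `O(M⁻¹)` letters and penalties ∕ overlap letter, 124's agreement of `Ũ^□` with
`U^{ĝ_□}` near `supp h_□`, the local invertibility and the unit `1 − R(u)` (as in 56), the two margins.  HONEST FRAMING: nothing of
Bałaban's `Δ^{(k)}(𝐔)` is constructed; derivative letters of the glued expansion ((ψ5)) NOT claimed; words of row (D4) UNCHANGED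
(`ExistsUniformAcrossSmall` + `TermDomination`, OBJECT level); (D4) instance 0∕1; NOT BetaPertH, NOT continuum, NOT Clay.
-/
import Summits.QuantumFields.BalabanUV.Gaps.D4WalkBlockTruncatedSeeds
import Summits.QuantumFields.BalabanUV.Gaps.D4WalkBlockTruncationWindows
import Summits.QuantumFields.BalabanUV.Gaps.D4WalkBlockFormGaugeFieldTorus
import Summits.QuantumFields.BalabanUV.Gaps.D4WalkBlockFormAveragingTorus
import Summits.QuantumFields.BalabanUV.Gaps.D4WalkBlockFormBaseTorus

/-!
# `Gaps.D4WalkBlockGaugeFieldGlued` — (3.87)–(3.90) for a lattice gauge field from χ-truncated gauge-fixed fields on the whole torus: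
# the one-scale covariant propagator is a glued block walk expansion (cell pub-balaban-gaps, seat g1-p2 gen 12)

HONEST DEPENDENCY (cell pub-balaban, verbatim): continuum YM on T⁴ ⇐ BetaPertH ∧ nine spine estimates (0/9 proved);
BetaPertH ⇐ (D1) ∧ (D4) ∧ CAP+tail.

[B9] p. 408 l. 1–6 (the (3.35) gauge makes `U′ = e^{iηA}` satisfy (3.37) on `□̃`), (3.87)–(3.90) p. 409, p. 410.  ROAD (c′): instead of the
Dirichlet propagators of the sub-domains `□̃`, the WHOLE-torus propagators of the truncated fields `Ũ^□ = e^{χ_□X^{(□)}}`.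
* §1 `rowSum_PU_le` (rows of `P_K(Ũ)` at most `1 + 2α_g + α_g²`), `differentiableOn_covOp_gaugeField` (entries of
  `Δ_{Ũ} + m² + a_KP_K(Ũ)` holomorphic from those of `e^{±χX}`).
* §2 **`blockWalkExpansion_covOp_glued_gaugeField`** — THE END: `∃ δ₀, C > 0` (66's) such that for every member of the one-scale torus
  family, every fibre size, every finite family of cubes with bond logarithms `X^{(□)}` (windows `(a₀, a₁)`), cutoffs `χ_□`
  (`0 ≤ χ ≤ 1`, `|χ_□(x) − χ_□(x − e)| ≤ ηc_χ`), gauges, partition, penalties and agreement data as in 130, under 66's margin at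
  `(a₀, a₁ + c_χa₀)` and 55's margin, `u ↦ (Δ_W(u) + m² + a_KP_K(U)(u))⁻¹` is a block walk expansion with dominating distances.
WHAT IT IS NOT.  The construction of `χ_□`, `h_□`, `ĝ_□`, `X^{(□)}` from a configuration `U` (107 holds the (3.35) dictionary) and their
letters; the covariant derivative letters ((ψ5)); OBJECT level untouched.

References: T. Bałaban, Comm. Math. Phys. **99** (1985) 389–434 [B9], (3.8) p. 392, (3.35)–(3.37) p. 396, Cor. 3.5 p. 407, p. 408,
(3.87)–(3.90) p. 409, p. 410; Comm. Math. Phys. **96** (1984) [4], Prop. 2.2 (2.67) p. 234; Comm. Math. Phys. **116** (1988) [II], (1.11) p. 5.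
-/

noncomputable section

namespace Summit.QuantumFields.BalabanUV.Gaps.D4WalkBlockGaugeFieldGlued

open Metric Set Finset NormedSpace
open scoped Matrix
open Literature.MathematicalPhysics.QuantumFieldTheory.Balaban1983to89
open Literature.MathematicalPhysics.QuantumFieldTheory.Balaban1983to89.B9SectDWalk (DomBy)
open Literature.MathematicalPhysics.QuantumFieldTheory.Balaban1983to89.B9Thm34Ext (toB6)
open Literature.MathematicalPhysics.QuantumFieldTheory.Balaban1983to89.B9Thm37GlueTorus (torusGeom tdist1)
open Literature.MathematicalPhysics.QuantumFieldTheory.Balaban1983to89.TreeLengthTorus (TPt)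
open Literature.MathematicalPhysics.QuantumFieldTheory.Balaban1983to89.B5TorusCover (UT)
open Literature.MathematicalPhysics.QuantumFieldTheory.Balaban1983to89.B11SectG (RowSum)
open Literature.MathematicalPhysics.QuantumFieldTheory.Balaban1983to89.B5Ineq137Torus (Nv blk)
open Literature.MathematicalPhysics.QuantumFieldTheory.Balaban1983to89.B6Prop22OneScaleTorus (Index)
open Summit.QuantumFields.BalabanUV.Gaps.D4WalkBlock (blockNorm BlockWalkExpansion)
open Summit.QuantumFields.BalabanUV.Gaps.D4WalkBlockFlatLetters (cubeOf)
open Summit.QuantumFields.BalabanUV.Gaps.D4WalkBlockShiftAlgebra (fibD)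
open Summit.QuantumFields.BalabanUV.Gaps.D4WalkBlockShiftWeighted (wOp)
open Summit.QuantumFields.BalabanUV.Gaps.D4WalkBlockTransportAlgebra (rowSumNorm colSumNorm)
open Summit.QuantumFields.BalabanUV.Gaps.D4WalkBlockShiftTransport (differentiableOn_defect')
open Summit.QuantumFields.BalabanUV.Gaps.D4WalkBlockCovariantShift (covDop covB covLap covShift flatLap flatLap_sub_covLap covShift_holo)
open Summit.QuantumFields.BalabanUV.Gaps.D4WalkBlockCovariantPropagator (covOp Pf)
open Summit.QuantumFields.BalabanUV.Gaps.D4WalkBlockCovariantBlockAveraging (PU differentiableOn_PU)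
open Summit.QuantumFields.BalabanUV.Gaps.D4WalkBlockGaugeField
open Summit.QuantumFields.BalabanUV.Gaps.D4WalkBlockTruncationWindows
  (truncation_window0 truncation_holo blockWalkExpansion_truncatedGaugeField_oneScaleTorus)
open Summit.QuantumFields.BalabanUV.Gaps.D4WalkBlockFormGaugeFieldTorus (window_Wp window_Wm)
open Summit.QuantumFields.BalabanUV.Gaps.D4WalkBlockFormAveragingTorus (rowSum_PU_sub_Pf_le)
open Summit.QuantumFields.BalabanUV.Gaps.D4WalkBlockFormBaseTorus (sum_norm_Pf_row)
open Summit.QuantumFields.BalabanUV.Gaps.D4WalkBlockTruncatedSeeds (blockWalkExpansion_covOp_glued)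

/-! ## §1. Rows of `P_K(Ũ)`, holomorphy of `Δ_{Ũ} + m² + a_KP_K(Ũ)` -/

section Inputs
variable {P : Params} {N : ℕ} {E : Type*} [NormedAddCommGroup E] [NormedSpace ℂ E]

omit [NormedSpace ℂ E] in
/-- rows of the genuine covariant projector: `Σ_q‖P_K(U)(u)_{pq}‖ ≤ 1 + 2α_g + α_g²` when the block-contour transporters have fibre row
letters `α_g` (115's `P_K(U) − P_K ⊗ 1` budget + 112's `Σ_q |(P_K ⊗ 1)_{pq}| = 1`). [cite: Balaban1985BackgroundPropagators, (3.8) p.392, (3.57)–(3.60) pp.401–402] -/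
theorem rowSum_PU_le {Ug Ugi : E → Site P 0 → Matrix (Fin N × Fin N) (Fin N × Fin N) ℂ} {R αg : ℝ} (hαg : 0 ≤ αg)
    (hUg : ∀ u ∈ ball (0 : E) R, ∀ x c, ∑ b, ‖(Ug u x - 1) c b‖ ≤ αg)
    (hUgi : ∀ u ∈ ball (0 : E) R, ∀ x c, ∑ b, ‖(Ugi u x - 1) c b‖ ≤ αg) :
    ∀ u ∈ ball (0 : E) R, ∀ p, ∑ q, ‖PU P (Fin N × Fin N) Ug Ugi u p q‖ ≤ 1 + (2 * αg + αg ^ 2) := by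
  intro u hu p
  have h1 := rowSum_PU_sub_Pf_le (P := P) (F := Fin N × Fin N) hαg hUg hUgi u hu p
  have h2 := sum_norm_Pf_row (P := P) (F := Fin N × Fin N) p
  calc ∑ q, ‖PU P (Fin N × Fin N) Ug Ugi u p q‖
      ≤ ∑ q, (‖Pf P (Fin N × Fin N) p q‖ + ‖(PU P (Fin N × Fin N) Ug Ugi u - Pf P (Fin N × Fin N)) p q‖) :=
        Finset.sum_le_sum fun q _ => by
          have e : PU P (Fin N × Fin N) Ug Ugi u p q = Pf P (Fin N × Fin N) p q + (PU P (Fin N × Fin N) Ug Ugi u - Pf P (Fin N × Fin N)) p q := by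
            rw [Matrix.sub_apply]; ring
          rw [e]; exact norm_add_le _ _
    _ ≤ 1 + (2 * αg + αg ^ 2) := by rw [Finset.sum_add_distrib, h2]; linarith

/-- **entries of `Δ_{Ũ}(u) + m² + a_KP_K(Ũ)(u)` are holomorphic** when those of `e^{±X(u)}` are (59b `covShift_holo` via
`Δ_W = Δ_1⊗1 − V_W`, 64 `differentiableOn_PU`, 66 `holo_Gc`). [cite: Balaban1985BackgroundPropagators, p.400, Cor. 3.5 p.407] -/
theorem differentiableOn_covOp_gaugeField {Xf : Fin P.d → E → Site P 0 → Matrix (Fin N) (Fin N) ℂ}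
    {Γ : Site P 0 → List (Fin P.d × Site P 0)} {R a msq : ℝ}
    (hUp : ∀ ν x a' c, DifferentiableOn ℂ (fun u => exp (Xf ν u x) a' c) (ball (0 : E) R))
    (hUpi : ∀ ν x a' c, DifferentiableOn ℂ (fun u => exp (-Xf ν u x) a' c) (ball (0 : E) R)) (p q : Site P 0 × (Fin N × Fin N)) :
    DifferentiableOn ℂ (fun u => covOp P (Fin N × Fin N) (Wp P N Xf) (Wm P N Xf) (PU P (Fin N × Fin N) (Gc P N Xf Γ) (Gci P N Xf Γ))
      a msq u p q) (ball (0 : E) R) := by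
  have hWp : ∀ ν x a' b, DifferentiableOn ℂ (fun u => Wp P N Xf ν u x a' b) (ball (0 : E) R) :=
    fun ν x a' b => differentiableOn_defect' (fun c c' => hUp ν x c c') (fun c c' => hUpi ν x c c') a' b
  have hWm : ∀ ν x a' b, DifferentiableOn ℂ (fun u => Wm P N Xf ν u x a' b) (ball (0 : E) R) :=
    fun ν x a' b => differentiableOn_defect' (fun c c' => hUpi ν _ c c') (fun c c' => hUp ν _ c c') a' b
  obtain ⟨hGc, hGci⟩ := holo_Gc P N Xf Γ hUp hUpi
  have e : ∀ u, covOp P (Fin N × Fin N) (Wp P N Xf) (Wm P N Xf) (PU P (Fin N × Fin N) (Gc P N Xf Γ) (Gci P N Xf Γ)) a msq u p q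
      = (flatLap P (Fin N × Fin N) p q - covShift P (Fin N × Fin N) (Wp P N Xf) (Wm P N Xf) u p q)
        + (msq : ℂ) * (1 : Matrix (Site P 0 × (Fin N × Fin N)) (Site P 0 × (Fin N × Fin N)) ℂ) p q
        + (B1RG242Torus.α P a P.K : ℂ) * PU P (Fin N × Fin N) (Gc P N Xf Γ) (Gci P N Xf Γ) u p q := by
    intro u
    unfold covOp
    rw [← flatLap_sub_covLap (Wp := Wp P N Xf) (Wm := Wm P N Xf) u]
    simp only [Matrix.add_apply, Matrix.sub_apply, Matrix.smul_apply, smul_eq_mul, sub_sub_cancel]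
  simp only [e]
  exact (((differentiableOn_const _).sub (covShift_holo hWp hWm p q)).add (differentiableOn_const _)).add
    ((differentiableOn_const _).mul (differentiableOn_PU P (Fin N × Fin N) (Gc P N Xf Γ) (Gci P N Xf Γ) (fun x c b => hGc x c b)
      (fun x c b => hGci x c b) p q))

end Inputs

/-! ## §2. THE END for lattice gauge fields -/

section End
variable {d L : ℕ} {a msq : ℝ}
variable {dd N' : ℕ} {E : Type*} [NormedAddCommGroup E] [NormedSpace ℂ E]

/-- **ROAD (c′) FOR A LATTICE GAUGE FIELD: `(Δ_W + m² + a_KP_K(U))⁻¹` IS A BLOCK WALK EXPANSION GLUED FROM THE WHOLE-TORUS PROPAGATORS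
OF PER-CUBE GAUGE-FIXED (TRUNCATED) FIELDS.**  `∃ δ₀, C > 0` (66's) such that for every member `i` of the one-scale torus family, every
fibre size `N`, every finite family of cubes `b` carrying bond logarithms `Y^{(b)}_ν(u,x)` ON THE WHOLE TORUS with 66's two (3.37)-windows
`(a₀, a₁)` and holomorphic exponentials (126: the χ-truncations `χ_b·X^{(b)}` of per-cube (3.35) data have them with `a₁ ↦ a₁ + c_χa₀`),
an in-cube contour system, 66's rates and MARGIN (giving each `A′_b⁻¹ = (Δ_{Ũ_b} + m² + a_KP_K(Ũ_b))⁻¹` as a block walk expansion with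
`covDop` letters, `Ũ_b = exp Y^{(b)}`), and 130's data — gauges `(g_b, g_b⁻¹)` (fibre rows `≤ r_g`), a partition `Σ_b h_b² = 1`
(`|h_b| ≤ 1`, `supp h_b ⊆ S_b`, letters `δ₁, Λ, ω`, penalties `pen_b`, overlap `N`), 124's agreement of `(W̃^±_b, Ũ_b(Γ))` with the gauged
data of the field `(W^±, U(Γ))` on what the columns over `S_b` read, local invertibility, the unit `1 − R(u)`, a second cube row sum
`(μ₂, c_μ₂)` and 55's MARGIN with `θ ≥ Σ_μ(1 + ηβ)δ₁(covB_{inl μ} + covB_{inr μ}) + d(Λ + 2δ₁β) + |a_K|ωπ`, `β = 2B + B²`,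
`π = 1 + 2α_g + α_g²` (`B = a₀e^{a₀}`, `α_g = letterG ℓ a₀`) —: `u ↦ (Δ_W(u) + m² + a_KP_K(U)(u))⁻¹` is a block walk expansion with
dominating distances; NO sub-domain, NO Dirichlet propagator, NO compression; no constant depends on `K` or the volume.
[cite: Balaban1985BackgroundPropagators, (3.87)–(3.90) p.409, p.410, p.408, Cor. 3.5 p.407, Cor. 3.6 p.408, (3.35)–(3.37) p.396, (3.8) p.392; Balaban1984PropagatorsII, Prop. 2.2 (2.67) p.234; Balaban1988RG2Cluster, (1.11) p.5, p.13, p.15] -/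
theorem blockWalkExpansion_covOp_glued_gaugeField (hd : 1 ≤ d) (hL : Odd L ∧ 1 < L) (ha : 0 < a) (hmsq : 0 ≤ msq) :
    ∃ δ₀ C : ℝ, 0 < δ₀ ∧ 0 < C ∧ ∀ (i : Index d L) (N : ℕ) (c₀ : B13.Consts) (X : Finset (UT (Nv i.P i.P.K))) (R : ℝ)
      (B : Type) (_ : Fintype B) (_ : DecidableEq B)
      (Wp₀ Wm₀ : Fin i.P.d → E → Site i.P 0 → Matrix (Fin N × Fin N) (Fin N × Fin N) ℂ)
      (Ug₀ Ugi₀ : E → Site i.P 0 → Matrix (Fin N × Fin N) (Fin N × Fin N) ℂ)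
      (Yl : B → Fin i.P.d → E → Site i.P 0 → Matrix (Fin N) (Fin N) ℂ) (Γ : Site i.P 0 → List (Fin i.P.d × Site i.P 0)) (Nc : ℕ)
      (g gi : B → Site i.P 0 → Matrix (Fin N × Fin N) (Fin N × Fin N) ℂ) (h : B → Site i.P 0 → ℝ) (S : B → Set (Site i.P 0))
      (pen : B → UT (Nv i.P i.P.K) → ℝ) (ℓ a₀ a₁ ε μ cμ μ₂ cμ₂ rg Nn δ₁ Λ ω θ : ℝ),
      -- 66's inputs for each local field
      (∀ b ν x a' c, DifferentiableOn ℂ (fun u => exp (Yl b ν u x) a' c) (ball (0 : E) R)) →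
      (∀ b ν x a' c, DifferentiableOn ℂ (fun u => exp (-Yl b ν u x) a' c) (ball (0 : E) R)) →
      0 ≤ a₀ → 0 ≤ a₁ → (∀ x, (Γ x).length ≤ Nc) → (Nc : ℝ) * i.P.eps ≤ ℓ → 0 ≤ ℓ →
      (∀ b ν, ∀ u ∈ ball (0 : E) R, ∀ x a', rowSumNorm (Yl b ν u x) a' ≤ i.P.eps * a₀ ∧ colSumNorm (Yl b ν u x) a' ≤ i.P.eps * a₀) →
      (∀ b ν, ∀ u ∈ ball (0 : E) R, ∀ x a', rowSumNorm (Yl b ν u x - Yl b ν u (Site.unshift x ν)) a' ≤ i.P.eps ^ 2 * a₁ ∧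
        colSumNorm (Yl b ν u x - Yl b ν u (Site.unshift x ν)) a' ≤ i.P.eps ^ 2 * a₁) →
      0 ≤ μ → 2 * μ ≤ ε → 2 * μ ≤ δ₀ / 2 - ε - μ → 0 ≤ cμ →
      RowSum (toB6 (torusGeom (Nv i.P i.P.K) 0 0 0) 0 True) μ cμ →
      cμ * (cμ * 1 * (1 * (((i.P.d : ℝ) * (2 * (a₁ * Real.exp a₀) + 4 * letterB a₀ ^ 2) +
        B1RG242Torus.α i.P a i.P.K * (2 * letterG ℓ a₀ + letterG ℓ a₀ ^ 2) +
        ∑ ι, (2 * letterB a₀ + letterB a₀ ^ 2) * covB i.P δ₀ ι) * C)) * cμ) * cμ < 1 →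
      -- gauges, partition, penalties, overlap (130)
      0 ≤ rg → (∀ b x a', ∑ b', ‖g b x a' b'‖ ≤ rg) → (∀ b x a', ∑ b', ‖gi b x a' b'‖ ≤ rg) → (∀ b x, |h b x| ≤ 1) →
      (∀ b y, 0 ≤ pen b y) → (∀ b x, pen b (cubeOf i.P x) ≠ 0 → h b x = 0) →
      (∀ b x ν, pen b (cubeOf i.P x) ≠ 0 → h b (Site.shift x ν) = 0 ∧ h b (Site.unshift x ν) = 0) →
      (∀ y, ∑ b, Real.exp (-(((δ₀ / 2 - 2 * μ) - (ε - 2 * μ)) * pen b y)) ≤ Nn) →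
      0 ≤ δ₁ → 0 ≤ Λ → 0 ≤ ω →
      (∀ b ν y, |i.P.eps⁻¹ * (h b (Site.shift y ν) - h b y)| ≤ δ₁) →
      (∀ b ν y, |i.P.eps⁻¹ * (h b y - h b (Site.unshift y ν))| ≤ δ₁) →
      (∀ b ν y, |(i.P.eps⁻¹) ^ 2 * (h b (Site.shift y ν) - 2 * h b y + h b (Site.unshift y ν))| ≤ Λ) →
      (∀ b x x', blk i.P i.P.K x = blk i.P i.P.K x' → |h b x - h b x'| ≤ ω) →
      (∑ ν : Fin i.P.d, (1 + i.P.eps * (2 * letterB a₀ + letterB a₀ ^ 2)) * δ₁ * (covB i.P δ₀ (Sum.inl ν) + covB i.P δ₀ (Sum.inr ν))) +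
        (i.P.d : ℝ) * (Λ + δ₁ * (2 * letterB a₀ + letterB a₀ ^ 2) + δ₁ * (2 * letterB a₀ + letterB a₀ ^ 2)) +
        |B1RG242Torus.α i.P a i.P.K| * (ω * (1 + (2 * letterG ℓ a₀ + letterG ℓ a₀ ^ 2))) ≤ θ →
      -- the resummation data (124): gauges, partition of unity, agreement with the gauged field, local invertibility, the unit
      (∀ b x, g b x * gi b x = 1) → (∀ b x, gi b x * g b x = 1) → (∀ b y, y ∉ S b → h b y = 0) → (∀ x, ∑ b, h b x ^ 2 = 1) →
      (∀ u ∈ ball (0 : E) R, ∀ b ν y, y ∈ S b → Wp i.P N (Yl b) ν u (Site.unshift y ν) =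
        g b (Site.unshift y ν) * (1 + Wp₀ ν u (Site.unshift y ν)) * gi b (Site.shift (Site.unshift y ν) ν) - 1) →
      (∀ u ∈ ball (0 : E) R, ∀ b ν y, y ∈ S b → Wm i.P N (Yl b) ν u (Site.shift y ν) =
        g b (Site.shift y ν) * (1 + Wm₀ ν u (Site.shift y ν)) * gi b (Site.unshift (Site.shift y ν) ν) - 1) →
      (∀ u ∈ ball (0 : E) R, ∀ b x y, y ∈ S b → blk i.P i.P.K x = blk i.P i.P.K y → Gci i.P N (Yl b) Γ u x = g b x * Ugi₀ u x) →
      (∀ u ∈ ball (0 : E) R, ∀ b y, y ∈ S b → Gc i.P N (Yl b) Γ u y = Ug₀ u y * gi b y) →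
      (∀ b, ∀ u ∈ ball (0 : E) R, IsUnit (covOp i.P (Fin N × Fin N) (Wp i.P N (Yl b)) (Wm i.P N (Yl b)) (PU i.P (Fin N × Fin N) (Gc i.P N (Yl b) Γ) (Gci i.P N (Yl b) Γ)) a msq u).det) →
      (∀ u ∈ ball (0 : E) R, IsUnit (1 - ∑ b, fibD (Site i.P 0) (Fin N × Fin N) (gi b) *
        ((wOp (Site i.P 0) (Fin N × Fin N) (h b) * covOp i.P (Fin N × Fin N) (Wp i.P N (Yl b)) (Wm i.P N (Yl b)) (PU i.P (Fin N × Fin N) (Gc i.P N (Yl b) Γ) (Gci i.P N (Yl b) Γ)) a msq u -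
            covOp i.P (Fin N × Fin N) (Wp i.P N (Yl b)) (Wm i.P N (Yl b)) (PU i.P (Fin N × Fin N) (Gc i.P N (Yl b) Γ) (Gci i.P N (Yl b) Γ)) a msq u * wOp (Site i.P 0) (Fin N × Fin N) (h b)) *
          (covOp i.P (Fin N × Fin N) (Wp i.P N (Yl b)) (Wm i.P N (Yl b)) (PU i.P (Fin N × Fin N) (Gc i.P N (Yl b) Γ) (Gci i.P N (Yl b) Γ)) a msq u)⁻¹) *
        fibD (Site i.P 0) (Fin N × Fin N) (fun x => (((h b x : ℝ) : ℂ)) • g b x)).det) →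
      -- 55's rates and margin at 66's output rates
      0 ≤ μ₂ → 2 * μ₂ ≤ ε - 2 * μ → 2 * μ₂ ≤ δ₀ / 2 - ε - μ - 2 * μ →
      (δ₀ / 2 - ε - μ - 2 * μ) + μ₂ ≤ (δ₀ / 2 - 2 * μ) - (ε - 2 * μ) → 0 ≤ cμ₂ →
      RowSum (toB6 (torusGeom (Nv i.P i.P.K) 0 0 0) 0 True) μ₂ cμ₂ →
      cμ₂ * (cμ₂ * 1 * (1 * (Nn * (rg * rg * (θ *
        (cμ * C * (1 * (1 - cμ * (cμ * 1 * (1 * (((i.P.d : ℝ) * (2 * (a₁ * Real.exp a₀) + 4 * letterB a₀ ^ 2) +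
            B1RG242Torus.α i.P a i.P.K * (2 * letterG ℓ a₀ + letterG ℓ a₀ ^ 2) +
            ∑ ι, (2 * letterB a₀ + letterB a₀ ^ 2) * covB i.P δ₀ ι) * C)) * cμ) * cμ)⁻¹) * cμ))))) * cμ₂) * cμ₂ < 1 →
      ∃ (W' : Type) (T' : W' → (TPt dd N' → ℂ) → E → Matrix (Site i.P 0 × (Fin N × Fin N)) (Site i.P 0 × (Fin N × Fin N)) ℂ)
        (SX' : Set W') (A' : W' → ℝ) (D' : W' → UT (Nv i.P i.P.K) → UT (Nv i.P i.P.K) → ℝ),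
        BlockWalkExpansion c₀ (fun q : Site i.P 0 × (Fin N × Fin N) => cubeOf i.P q.1) (fun q => cubeOf i.P q.1)
          (fun (_ : TPt dd N' → ℂ) u => (covOp i.P (Fin N × Fin N) Wp₀ Wm₀ (PU i.P (Fin N × Fin N) Ug₀ Ugi₀) a msq u)⁻¹) X R
          (ε - 2 * μ - 2 * μ₂) (δ₀ / 2 - ε - μ - 2 * μ - 2 * μ₂)
          (cμ₂ * (Nn * (rg * rg *
            (cμ * C * (1 * (1 - cμ * (cμ * 1 * (1 * (((i.P.d : ℝ) * (2 * (a₁ * Real.exp a₀) + 4 * letterB a₀ ^ 2) +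
            B1RG242Torus.α i.P a i.P.K * (2 * letterG ℓ a₀ + letterG ℓ a₀ ^ 2) +
            ∑ ι, (2 * letterB a₀ + letterB a₀ ^ 2) * covB i.P δ₀ ι) * C)) * cμ) * cμ)⁻¹) * cμ))) *
            (1 * (1 - cμ₂ * (cμ₂ * 1 * (1 * (Nn * (rg * rg * (θ *
              (cμ * C * (1 * (1 - cμ * (cμ * 1 * (1 * (((i.P.d : ℝ) * (2 * (a₁ * Real.exp a₀) + 4 * letterB a₀ ^ 2) +
            B1RG242Torus.α i.P a i.P.K * (2 * letterG ℓ a₀ + letterG ℓ a₀ ^ 2) +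
            ∑ ι, (2 * letterB a₀ + letterB a₀ ^ 2) * covB i.P δ₀ ι) * C)) * cμ) * cμ)⁻¹) * cμ))))) * cμ₂) * cμ₂)⁻¹) * cμ₂)
          T' SX' A' D' (δ₀ / 2 - 2 * μ - 2 * μ₂) ∧
        ∀ ω', DomBy (toB6 (torusGeom (Nv i.P i.P.K) 0 0 0) 0 True) (D' ω') := by
  obtain ⟨δ₀, C, hδ₀, hC, h66⟩ := blockWalkExpansion_gaugeField_oneScaleTorus (dd := dd) (N' := N') (E := E) hd hL ha hmsq
  refine ⟨δ₀, C, hδ₀, hC, ?_⟩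
  intro i N c₀ X R B _ _ Wp₀ Wm₀ Ug₀ Ugi₀ Yl Γ Nc g gi h S pen ℓ a₀ a₁ ε μ cμ μ₂ cμ₂ rg Nn δ₁ Λ ω θ hUp hUpi ha₀ ha₁ hΓ hNc hℓ hw0 hw1
    hμ hμε hμκ hcμ hrow hq66 hrg hgr hgir hh1 hpen0 hpenh hpenN hN hδ₁ hΛ hω hdp hdm hlap hosc hθ hg hgi hhS hsum hp hm hUgi hUg hA'
    hunit hμ₂ hμ₂ε hμ₂κ hwin₂ hcμ₂ hrow₂ hq
  -- per-cube whole-torus expansions from 66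
  have h66b := fun b => h66 i N c₀ X R (Yl b) Γ Nc ℓ a₀ a₁ ε μ cμ (hUp b) (hUpi b) ha₀ ha₁ hΓ hNc hℓ (hw0 b) (hw1 b) hμ hμε hμκ hcμ
    hrow hq66
  choose W T SX A D hG hGD hGdom using h66b
  have hq1 : 0 < 1 - cμ * (cμ * 1 * (1 * (((i.P.d : ℝ) * (2 * (a₁ * Real.exp a₀) + 4 * letterB a₀ ^ 2) +
        B1RG242Torus.α i.P a i.P.K * (2 * letterG ℓ a₀ + letterG ℓ a₀ ^ 2) +
        ∑ ι, (2 * letterB a₀ + letterB a₀ ^ 2) * covB i.P δ₀ ι) * C)) * cμ) * cμ := by linarith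
  have hB0 : 0 ≤ letterB a₀ := by unfold letterB; positivity
  have hGpos : 0 ≤ letterG ℓ a₀ := by
    have : 0 ≤ Real.exp (ℓ * letterB a₀) - 1 := by
      have : 0 ≤ ℓ * letterB a₀ := mul_nonneg hℓ hB0
      linarith [Real.add_one_le_exp (ℓ * letterB a₀)]
    unfold letterG; positivity
  have hβ0 : 0 ≤ 2 * letterB a₀ + letterB a₀ ^ 2 := by positivity
  have hπ0 : 0 ≤ 1 + (2 * letterG ℓ a₀ + letterG ℓ a₀ ^ 2) := by positivity
  have hGc := fun b => fibre_contour_letters i.P N (Yl b) Γ ha₀ hΓ hNc hℓ (hw0 b)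
  exact blockWalkExpansion_covOp_glued (P := i.P) (F := Fin N × Fin N)
    (Wpl := fun b => Wp i.P N (Yl b)) (Wml := fun b => Wm i.P N (Yl b))
    (Ugl := fun b => Gc i.P N (Yl b) Γ) (Ugil := fun b => Gci i.P N (Yl b) Γ) hG hGD hGdom (by linarith) (by positivity) hrg hgr hgir
    hh1 hpen0 hpenh hpenN hN (fun b p q => differentiableOn_covOp_gaugeField (hUp b) (hUpi b) p q) hδ₁ hΛ hβ0 hω hπ0 hdp hdm hlap
    (fun b ν u hu x a' => (window_Wp ha₀ (hw0 b) ν u hu x a').1) (fun b ν u hu x a' => (window_Wm ha₀ (hw0 b) ν u hu x a').1) hosc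
    (fun b u hu p => rowSum_PU_le hGpos (fun u hu x c => (hGc b u hu x c).1) (fun u hu x c => (hGc b u hu x c).2) u hu p) hθ
    hg hgi hhS hsum hp hm hUgi hUg hA' hunit hμ₂ hμ₂ε hμ₂κ hwin₂ hcμ₂ hrow₂ hq

end End

end Summit.QuantumFields.BalabanUV.Gaps.D4WalkBlockGaugeFieldGlued

end
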